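import Literature.Probability.Percolation.KhSThreeDisorderObservable
import Literature.Probability.Percolation.FivePointContour
import Literature.Probability.Percolation.SmirnovDiscreteCauchy
import HarnessLib

/-!
# Khristoforov–Smirnov's Corollary 5 at `k = 3`: the discrete contour integrals of `F` vanish

Topic `Literature/Probability/Percolation`; lane pcv-sawmu (CriticalPhenomena), door D1 (three disorders, loop form). The printed
consequence of the discrete holomorphicity (Lemma 4, `MarkedLoops.khsLemma4_holds` of `KhSThreeDisorderObservable.lean`) of the
three-disorder observable `F = Σ_j τ^j H_j` of a 3-marked discrete domain (Definition 3, `MarkedLoops.Fobs`): Corollary 5 — the discrete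
integral `∮^#_γ F(z) d^# z := Σ_m F(e_m) (w°_{m+1} − w°_m)` along a dual contour vanishes. As in the paper's proof («any contour can be
decomposed into a union of elementary ones and the discrete integration is additive w.r.t. contour») a contour is taken to be the
BOUNDARY OF A FINITE SET `Λ` of vertices of the honeycomb lattice `H` (faces of `𝕋`, `HexVertex`), and the integral is the sum over the
dual edges leaving `Λ` of `F(e) · (x₊ − x₋)`, the displacement between the centres `x± = triEmbed (faceVertex v _)` of the two hexagons
flanking `e`, traversed anticlockwise about the inner face `v` (`bdryIntegral`; for `Λ` the faces enclosed by a simple dual contour `γ`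
this is literally `∮^#_γ F d^# z`). Scope: printed for an arbitrary dual contour; formalised for contours that bound a finite union of
elementary contours inside `Ω` — the decomposition the printed proof invokes.

* `sideDisp v j = x_{j+2}(v) − x_{j+1}(v)`, and `sideDisp_eq`: it equals `−u_v (τ − 1) τ · τ^j` (`u_v = oppFaceDir v`, `τ = e^{2πi/3} = ζ²`,
  private `tau_eq_triZeta_sq`) — the honeycomb geometry of `SmirnovDiscreteCauchy.lean` (`triEmbed_faceVertex_sub`, `hexCenter_oppFace_sub`:
  the vertices `faceVertex v 0, 1, 2` and the opposite faces `oppFace v 0, 1, 2` are anticlockwise); `sideDisp_oppFace_oppIdx`: the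
  opposite face traverses the common side the other way;
* `sum_mul_sideDisp_eq_zero`: the ELEMENTARY contour — `Σ_j τ^j F(z_j) = 0` at `v` gives `Σ_j F(z_j)(x_{j+2} − x_{j+1}) = 0`;
* `bdryIntegral_eq_zero`: for any edge function read identically from both faces of each edge and discretely holomorphic at every face
  of `Λ`, `∮_{∂Λ} F = 0` (inner sides cancel in pairs) — the telescoping of the paper's proof with its printed weights, next to the
  `ccwNbr`/sign form `FivePoint.Contour.contour_sum_eq_zero` of `FivePointContour.lean`;
* `fobs_oppFace_oppIdx`, `fobsAt_comm`: `F` IS a function of the mid-edge (the XOR space `loopSpaceX` and the classes `InClassX` depend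
  on the bond only through `s(u, w)`; the two halves of the subdivided edge are exchanged: `classCount_oppFace_oppIdx`);
* ★ `khsCorollary5`: `bdryIntegral (Fobs D) Λ = 0` for every finite `Λ` all of whose faces have their three sides in `H_G` (interior
  faces: `khsCorollary5_interior`; all such faces at once, the discrete `∮_{∂Ω}`: `khsGlobalContour_eq_zero`), and the same identity in
  the five-point bookkeeping, `khsContour_ccw_eq_zero` (from `khsLemma4_ccw`).

## References
* M. Khristoforov, S. Smirnov, *Percolation and O(1) loop model*, arXiv:2111.15612 (2021), §1.2 (pp. 2–3), §2 Definition 3 and Lemma 4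
  (p. 4), Corollary 5 with proof (p. 5) — arXiv v1 pages.
-/

open Finset

namespace Literature.Probability.Percolation.MarkedLoops

open Literature.Probability.Percolation Literature.Probability.LatticeModels
open Literature.Probability.Percolation.FivePoint (side tau ccwNbr)
open Literature.Probability.Percolation.FivePoint.N5 (side_oppFace_oppIdx)
open TriMarkedDomain

/-! ## The observable is a function of the mid-edge: the two faces of an edge give the same `F` -/

section EdgeSymmetry

variable {nm : ℕ} (D : TriMarkedDomain nm)

/-- the XOR space at a bond depends on the bond only through `s(u, w)`: it is symmetric in `u`, `w`.
[cite: KhristoforovSmirnov2021, §1.2 (loop configurations, arXiv v1 pp. 2–3)] -/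
theorem loopSpaceX_comm (u w : Site 2) (s : HexVertex) : loopSpaceX D u w s = loopSpaceX D w u s := by
  unfold loopSpaceX
  rw [Sym2.eq_swap]

/-- … and so is the class «the strand from `s` ends at the corner `y_j`». [cite: KhristoforovSmirnov2021, §2 Definition 3 (arXiv v1 p. 4)] -/
theorem inClassX_comm (u w : Site 2) (s : HexVertex) (j : Fin nm) (ξ : Finset (Sym2 (Site 2))) :
    InClassX D u w s j ξ ↔ InClassX D w u s j ξ := by
  unfold InClassX
  rw [loopSpaceX_comm]

open Classical in
/-- the class counts are symmetric in the two endpoints of the bond. [cite: KhristoforovSmirnov2021, §2 Definition 3 (arXiv v1 p. 4)] -/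
theorem card_filter_inClassX_comm (u w : Site 2) (s : HexVertex) (j : Fin nm) :
    #((loopSpaceX D u w s).filter fun ξ => InClassX D u w s j ξ) =
      #((loopSpaceX D w u s).filter fun ξ => InClassX D w u s j ξ) := by
  rw [loopSpaceX_comm D u w s]
  congr 1
  exact Finset.filter_congr fun ξ _ => inClassX_comm D u w s j ξ

/-- the XOR space at the `i`-th side of `v`, seen from the opposite face, is the same space. [cite: KhristoforovSmirnov2021, §1.2 (loop configurations, arXiv v1 pp. 2–3)] -/
theorem TXb_oppFace_oppIdx (v : HexVertex) (i : Fin 3) (s : HexVertex) :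
    TXb D (oppFace v i) (oppIdx v i) s = TXb D v i s := by
  unfold TXb
  rw [faceVertex_oppFace_succ, faceVertex_oppFace_succ_succ, loopSpaceX_comm]

end EdgeSymmetry

/-! ## The discrete integral along the boundary of a finite face set (honeycomb geometry, any edge function) -/

section DiscreteIntegral

/-- `τ = ζ²` (`τ = e^{2πi/3}` of the five-point files, `ζ = e^{iπ/3}` of `TriangularLattice`). [folklore] -/
private theorem tau_eq_triZeta_sq : tau = triZeta ^ 2 := by
  unfold FivePoint.tau triZeta
  rw [← Complex.exp_nat_mul]
  congr 1
  push_cast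
  ring

/-- the vertex `x_j = faceVertex v j` relative to the centre of `v`: `x_j − c_v = −u_v τ^j` (`u_v = oppFaceDir v`; the vertices are
labelled anticlockwise). [folklore] -/
private theorem triEmbed_faceVertex_sub_hexCenter (v : HexVertex) (j : Fin 3) :
    triEmbed (faceVertex v j) - hexCenter v = -(oppFaceDir v * tau ^ (j : ℕ)) := by
  rw [triEmbed_faceVertex_sub, hexCenter_oppFace_sub, tau_eq_triZeta_sq]

/-- **the displacement along the `j`-th side of the face `v` traversed ANTICLOCKWISE about `v`**: from the hexagon centre
`x_{j+1} = faceVertex v (j+1)` to `x_{j+2} = faceVertex v (j+2)` (Khristoforov–Smirnov's `w°_{m+1} − w°_m` for the two consecutive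
hexagons of a dual contour sharing the edge `e_m` dual to `side v j`). [cite: KhristoforovSmirnov2021, §2 Corollary 5 (arXiv v1 p. 5)] -/
noncomputable def sideDisp (v : HexVertex) (j : Fin 3) : ℂ :=
  triEmbed (faceVertex v (j + 2)) - triEmbed (faceVertex v (j + 1))

/-- `x_{j+2} − x_{j+1} = −u_v (τ − 1) τ · τ^j`: the three anticlockwise side displacements of a face are `τ^j` times a common
constant — the geometry that turns the elementary contour `Σ_m F(e_m)(w°_{m+1} − w°_m)` around one vertex into the `τ`-weighted sum of
Lemma 4. [cite: KhristoforovSmirnov2021, §2 Corollary 5, proof (arXiv v1 p. 5): «for an elementary contour … the equality follows from (3)»] -/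
theorem sideDisp_eq (v : HexVertex) (j : Fin 3) : sideDisp v j = -(oppFaceDir v * (tau - 1) * tau) * tau ^ (j : ℕ) := by
  unfold sideDisp
  have e : ∀ j' : Fin 3, j' + 1 + 1 = j' + 2 := by decide
  have h0 := triEmbed_faceVertex_sub_hexCenter v j
  have h1 := triEmbed_faceVertex_succ_sub v j
  have h2 := triEmbed_faceVertex_succ_sub v (j + 1)
  rw [e j] at h2
  rw [← tau_eq_triZeta_sq] at h1 h2
  linear_combination h2 + (tau - 1) * h1 + (tau - 1) * tau * h0

/-- the opposite face traverses the common side in the OPPOSITE direction — the cancellation behind «the discrete integration is additive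
w.r.t. contour». [cite: KhristoforovSmirnov2021, §2 Corollary 5, proof (arXiv v1 p. 5)] -/
theorem sideDisp_oppFace_oppIdx (v : HexVertex) (j : Fin 3) : sideDisp (oppFace v j) (oppIdx v j) = -sideDisp v j := by
  unfold sideDisp
  rw [faceVertex_oppFace_succ, faceVertex_oppFace_succ_succ]
  ring

/-- **the elementary contour**: if `Σ_j τ^j F(z_j) = 0` at the face `v` (discrete holomorphicity, Lemma 4) then
`Σ_j F(z_j) (x_{j+2} − x_{j+1}) = 0` — Khristoforov–Smirnov's «for an elementary contour (the three faces adjacent to the same vertex)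
the equality follows from (3)». [cite: KhristoforovSmirnov2021, §2 Corollary 5, proof (arXiv v1 p. 5)] -/
theorem sum_mul_sideDisp_eq_zero (F : HexVertex → Fin 3 → ℂ) (v : HexVertex) (h : ∑ j : Fin 3, tau ^ (j : ℕ) * F v j = 0) :
    ∑ j : Fin 3, F v j * sideDisp v j = 0 := by
  calc ∑ j : Fin 3, F v j * sideDisp v j
      = -(oppFaceDir v * (tau - 1) * tau) * ∑ j : Fin 3, tau ^ (j : ℕ) * F v j := by
        rw [Finset.mul_sum]
        exact Finset.sum_congr rfl fun j _ => by rw [sideDisp_eq]; ring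
    _ = 0 := by rw [h, mul_zero]

/-- **Khristoforov–Smirnov's discrete integral `∮^# F(z) d^# z` along the boundary of a finite set `Λ` of faces** (vertices of the
honeycomb lattice) of an edge function `F` (`F v j` = the value on the `j`-th side of `v`): the sum over the dual edges LEAVING `Λ` of
`F` times the displacement between the centres of the two hexagons flanking the edge, traversed anticlockwise about the inner face. For
`Λ` the faces enclosed by a simple dual contour `γ = (w_0, …, w_n = w_0)` this is the paper's `Σ_m F(e_m)(w°_{m+1} − w°_m)`; in general
it is the sum of the elementary contours of the faces of `Λ` («the discrete integration is additive w.r.t. contour»).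
[cite: KhristoforovSmirnov2021, §2 Corollary 5 (arXiv v1 p. 5)] -/
noncomputable def bdryIntegral (F : HexVertex → Fin 3 → ℂ) (Λ : Finset HexVertex) : ℂ :=
  ∑ v ∈ Λ, ∑ j ∈ (Finset.univ : Finset (Fin 3)).filter (fun j => oppFace v j ∉ Λ), F v j * sideDisp v j

/-- **the telescoping behind Corollary 5**: for an edge function read identically from both faces of each edge
(`F (oppFace v j) (oppIdx v j) = F v j`) and discretely holomorphic at every face of `Λ`, the discrete integral along `∂Λ` vanishes —
the elementary contours vanish and the inner sides cancel in pairs (adjacent faces traverse their common side in opposite directions).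
[cite: KhristoforovSmirnov2021, §2 Corollary 5, proof (arXiv v1 p. 5)] -/
theorem bdryIntegral_eq_zero (F : HexVertex → Fin 3 → ℂ) (hF : ∀ v j, F (oppFace v j) (oppIdx v j) = F v j)
    (Λ : Finset HexVertex) (hrel : ∀ v ∈ Λ, ∑ j : Fin 3, tau ^ (j : ℕ) * F v j = 0) : bdryIntegral F Λ = 0 := by
  unfold bdryIntegral
  -- the total over all sides of all faces vanishes face by face
  have htot : ∑ v ∈ Λ, ∑ j : Fin 3, F v j * sideDisp v j = 0 :=
    Finset.sum_eq_zero fun v hv => sum_mul_sideDisp_eq_zero F v (hrel v hv)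
  -- the inner sides cancel in pairs
  have hinner : ∑ v ∈ Λ, ∑ j ∈ (Finset.univ : Finset (Fin 3)).filter (fun j => oppFace v j ∈ Λ),
      F v j * sideDisp v j = 0 := by
    rw [← Finset.sum_finset_product' ((Λ ×ˢ (Finset.univ : Finset (Fin 3))).filter fun q => oppFace q.1 q.2 ∈ Λ) Λ
      (fun v => (Finset.univ : Finset (Fin 3)).filter (fun j => oppFace v j ∈ Λ))
      (by intro q; rw [Finset.mem_filter, Finset.mem_product, Finset.mem_filter]; simp)]
    refine Finset.sum_involution (fun q _ => (oppFace q.1 q.2, oppIdx q.1 q.2)) ?_ ?_ ?_ ?_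
    · intro q hq
      simp only
      rw [hF, sideDisp_oppFace_oppIdx]
      ring
    · intro q hq _ h
      exact (hexGraph_adj_oppFace q.1 q.2).ne (congrArg Prod.fst h).symm
    · intro q hq
      rw [Finset.mem_filter, Finset.mem_product] at hq ⊢
      exact ⟨⟨hq.2, Finset.mem_univ _⟩, by rw [oppFace_oppFace]; exact hq.1.1⟩
    · intro q hq
      simp only [oppFace_oppFace, oppIdx_oppFace, Prod.mk.eta]
  -- split the total
  have hsplit : ∀ v ∈ Λ, ∑ j : Fin 3, F v j * sideDisp v j =
      ∑ j ∈ (Finset.univ : Finset (Fin 3)).filter (fun j => oppFace v j ∈ Λ), F v j * sideDisp v j +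
      ∑ j ∈ (Finset.univ : Finset (Fin 3)).filter (fun j => oppFace v j ∉ Λ), F v j * sideDisp v j :=
    fun v _ => (Finset.sum_filter_add_sum_filter_not _ _ _).symm
  rw [Finset.sum_congr rfl hsplit, Finset.sum_add_distrib, hinner, zero_add] at htot
  exact htot

end DiscreteIntegral

section ThreeMarksContour

variable (D : TriMarkedDomain 3)

open Classical in
/-- **`N_j(z)` is a function of the mid-edge `z`**: counted from either face of the edge it is the same number (the two halves of the
subdivided edge are exchanged). [cite: KhristoforovSmirnov2021, §2 Definition 3 (arXiv v1 p. 4)] -/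
theorem classCount_oppFace_oppIdx (v : HexVertex) (i j : Fin 3) :
    classCount D (oppFace v i) (oppIdx v i) j = classCount D v i j := by
  unfold classCount TXb
  rw [faceVertex_oppFace_succ, faceVertex_oppFace_succ_succ, oppFace_oppFace, add_comm,
    card_filter_inClassX_comm D (faceVertex v (i + 2)) (faceVertex v (i + 1)) v j,
    card_filter_inClassX_comm D (faceVertex v (i + 2)) (faceVertex v (i + 1)) (oppFace v i) j]

/-- `H_j(z)` is a function of the mid-edge. [cite: KhristoforovSmirnov2021, §2 Definition 3 (arXiv v1 p. 4)] -/
theorem hobs_oppFace_oppIdx (v : HexVertex) (i j : Fin 3) : Hobs D (oppFace v i) (oppIdx v i) j = Hobs D v i j := by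
  unfold Hobs
  rw [classCount_oppFace_oppIdx]

/-- **`F(z)` is a function of the mid-edge `z`**: `F` at the `i`-th side of `v` equals `F` at the same side seen from `oppFace v i`.
[cite: KhristoforovSmirnov2021, §2 Definition 3 (arXiv v1 p. 4)] -/
theorem fobs_oppFace_oppIdx (v : HexVertex) (i : Fin 3) : Fobs D (oppFace v i) (oppIdx v i) = Fobs D v i := by
  unfold Fobs
  exact Finset.sum_congr rfl fun j _ => by rw [hobs_oppFace_oppIdx]

/-- `FobsAt` is symmetric in the two faces of the edge (and `0` on non-adjacent pairs). [cite: KhristoforovSmirnov2021, §2 Definition 3 (arXiv v1 p. 4)] -/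
theorem fobsAt_comm (v w : HexVertex) : FobsAt D v w = FobsAt D w v := by
  by_cases h : ∃ i : Fin 3, oppFace v i = w
  · obtain ⟨i, rfl⟩ := h
    have e : FobsAt D (oppFace v i) v = Fobs D (oppFace v i) (oppIdx v i) := by
      have := fobsAt_oppFace D (oppFace v i) (oppIdx v i)
      rwa [oppFace_oppFace] at this
    rw [fobsAt_oppFace, e, fobs_oppFace_oppIdx]
  · have h' : ¬ ∃ i' : Fin 3, oppFace w i' = v := by
      rintro ⟨i', rfl⟩
      exact h ⟨oppIdx w i', oppFace_oppFace w i'⟩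
    unfold FobsAt
    rw [dif_neg h, dif_neg h']

/-! ## Corollary 5 for the three-disorder observable -/

/-- ★ **KHRISTOFOROV–SMIRNOV'S COROLLARY 5 (`k = 3`)**: the discrete integral of the observable `F = Σ_j τ^j H_j` of a 3-marked domain
(Definition 3, `Fobs`) along the boundary of ANY finite set of faces each having its three sides in `H_G` vanishes (Lemma 4
`khsLemma4_holds` at each face, and `F` is a function of the mid-edge, `fobs_oppFace_oppIdx`). [cite: KhristoforovSmirnov2021, §2 Corollary 5 (arXiv v1 p. 5)] -/
theorem khsCorollary5 (Λ : Finset HexVertex) (hΛ : ∀ v ∈ Λ, AllSides D v) : bdryIntegral (Fobs D) Λ = 0 :=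
  bdryIntegral_eq_zero (Fobs D) (fobs_oppFace_oppIdx D) Λ fun v hv => khsLemma4_holds D v (hΛ v hv)

/-- Corollary 5 around every finite set of INTERIOR faces (all three sites in `G`). [cite: KhristoforovSmirnov2021, §2 Corollary 5 (arXiv v1 p. 5)] -/
theorem khsCorollary5_interior (Λ : Finset HexVertex) (hΛ : ∀ v ∈ Λ, hexFaceVertices v ⊆ D.verts) : bdryIntegral (Fobs D) Λ = 0 :=
  khsCorollary5 D Λ fun v hv => allSides_of_subset (hΛ v hv)

open Classical in
/-- the faces of `𝕋` touching `G` with all three sides in `H_G` (all vertices of `H_G` at which Lemma 4 applies). [cite: KhristoforovSmirnov2021, §2 Lemma 4 (arXiv v1 p. 4)] -/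
noncomputable def allSidesFaces₃ (D : TriMarkedDomain 3) : Finset HexVertex :=
  (triFacesTouching D.verts).filter fun v => AllSides D v

/-- ★ **the global discrete contour identity of a 3-marked domain**: the discrete integral of `F` along the boundary of the set of ALL
faces with three `H_G`-sides — the discrete `∮_{∂Ω} F(z) d^# z` — vanishes. [cite: KhristoforovSmirnov2021, §2 Corollary 5 (arXiv v1 p. 5)] -/
theorem khsGlobalContour_eq_zero : bdryIntegral (Fobs D) (allSidesFaces₃ D) = 0 := by
  classical
  exact khsCorollary5 D _ fun v hv => by
    unfold allSidesFaces₃ at hv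
    exact (Finset.mem_filter.1 hv).2

/-- **Corollary 5 in the bookkeeping of the five-point files** (`ccwNbr`, orientation sign `Contour.sgn`, weights `τ^k`): an instance of
the abstract telescoping lemma `FivePoint.Contour.contour_sum_eq_zero` with the relation `khsLemma4_ccw` at every face of `Λ` and the
edge symmetry `fobsAt_comm`. [cite: KhristoforovSmirnov2021, §2 Corollary 5 (arXiv v1 p. 5)] -/
theorem khsContour_ccw_eq_zero (Λ : Finset HexVertex) (hΛ : ∀ v ∈ Λ, AllSides D v) :
    ∑ v ∈ Λ, ∑ k ∈ (Finset.univ : Finset (Fin 3)).filter (fun k => ccwNbr v k ∉ Λ),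
      FivePoint.Contour.sgn v * tau ^ (k : ℕ) * FobsAt D v (ccwNbr v k) = 0 :=
  FivePoint.Contour.contour_sum_eq_zero (FobsAt D) (fobsAt_comm D) Λ fun v hv => khsLemma4_ccw D v (hΛ v hv)

end ThreeMarksContour

end Literature.Probability.Percolation.MarkedLoops
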